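import Mathlib
import Summits.RiemannHypothesis.RiemannHypothesis.Theorems.JensenPolynomialsDefs
import Summits.RiemannHypothesis.RiemannHypothesis.Theorems.JensenPolynomialsCumulantDefs
import Summits.RiemannHypothesis.RiemannHypothesis.Theorems.JensenPolynomialsXiGorttwCoeffSmallTableAlgebra
import Literature.NumberTheory.LFunctions.XiMoments

/-!
# Route `JensenPolynomials` — C0, the CUMULANT IDENTITY, proved for every real sequence (RH-FREE, ξ-free)

**C0 `CumulantCoeffIdentity γ` (support child `XiCumulantIdentity` of the foreseen tenure split of the ANALYTIC crux
`XiGorttwCoeffSmallAnalytic`, THEORY-JENSEN.md §10.8; statements in `JensenPolynomialsCumulantDefs`): for every real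
sequence `γ`, every `d ≥ 3`, `j ≤ d` and shift `n` with `Δ(M)² > 0`, `γ(M) ≠ 0`, `γ(M−1) ≠ 0` (`M = n + d`),
GORTTW's Hermite coefficients of the normalised Jensen polynomial are the cumulant polynomials:**

  `c_{d,n,j} = (d)_j · e_j(Ũ₃(M), …, Ũ_j(M))`,   `e_j = [s^j] exp(Σ_{k≥3} Ũ_k s^k/k!)`,   `Ũ_k = ũ_k/Δ^k`,

where `ũ_k(M)` are the cumulants of the downward window ratios `r̃_k(M) = γ(M−k)γ(M)^{k−1}/γ(M−1)^k`
(`windowCumulant`, moment→cumulant recursion) — `cumulantCoeffIdentity_holds`, and its instance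
`xiCumulantIdentity_holds : CumulantCoeffIdentity xiTaylorCoeff`.

## Proof (generating functions as formal power series over `ℝ`; no analysis)

Umbrally `J̃^{d,n}(X) = E[(X + (Y − 1)/Δ)^d]` with `E[Y^k] = r̃_k`; since `Σ_k H_k(X/2) s^k/k! = e^{Xs − s²}` and the
cumulants of `(Y − 1)/Δ` are `(0, −2, Ũ₃, Ũ₄, …)` (`ũ₁ = 1`, `ũ₂ = −2Δ²`), the Gaussian part is absorbed by the Hermite
basis.  Formally (§1) a "formal exponential of `G`" is a power series `F` with `F(0) = 1`, `F′ = G′F`: unique, closed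
under products and rescaling, with `e^{−X}`, `e^{X²}` explicit; (§2–3) the recursions DEFINING `windowCumulant` and
`cumulantCoeff` say that `R = Σ w_kX^k/k!` (window moments, `w = CoeffTable.wR`) is the formal exponential of
`U = Σ ũ_kX^k/k!` and `E = Σ e_jX^j` that of `K = Σ_{k≥3} Ũ_kX^k/k!`; (§5) `U(X/Δ) − X/Δ + X² = K`; (§6) hence
`e^{X²}·(R·e^{−X})(X/Δ) = E`; (§7–8) extracting `[X^j]` and comparing with the eng seat's closed form
`CoeffTable.gorttwCoeff_mul_delta_pow` (`c_{d,n,j}Δ^j = Σ_{2i≤j} (Δ²)^i (d−j+2i)!/(i!(d−j)!) S_{d−j+2i}`, with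
`S_{d−j'} = C(d,j')·j'!·[X^{j'}](R·e^{−X})` by `Nat.choose_mul`) gives the identity.

Cell rh-jensen (HUMAN RULING D-0040), rung J-P(P1′) route `JensenPolynomials`; theory round-5 item (f) "C0 kernel proof
(generating functions) — a prover task".  WHAT THIS IS NOT: an algebraic identity valid for ANY real sequence; it says
nothing about `ξ` or about zeros of `ζ`.
-/

noncomputable section
-- D-0017: `Summit.RiemannHypothesis.RiemannHypothesis.…` duplicates the namespace BY DESIGN (single-problem summit).
set_option linter.dupNamespace false

open Finset
open scoped Nat

namespace Summit.RiemannHypothesis.RiemannHypothesis.Theorems.JensenPolynomials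

open Literature.NumberTheory.LFunctions

namespace Cumulant

open PowerSeries

/-- Uniqueness for the formal ODE `F′ = G′·F` with `F(0) = 1`: the solution is determined by `G′`. -/
theorem expODE_unique {F F' G : PowerSeries ℝ}
    (hF0 : constantCoeff F = 1) (hF : d⁄dX ℝ F = d⁄dX ℝ G * F)
    (hF0' : constantCoeff F' = 1) (hF' : d⁄dX ℝ F' = d⁄dX ℝ G * F') : F = F' := by
  suffices h : ∀ n, ∀ m ≤ n, coeff m F = coeff m F' by
    ext n; exact h n n le_rfl
  intro n
  induction n with
  | zero =>
    intro m hm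
    obtain rfl : m = 0 := by omega
    rw [coeff_zero_eq_constantCoeff_apply, coeff_zero_eq_constantCoeff_apply, hF0, hF0']
  | succ n ih =>
    intro m hm
    rcases Nat.lt_or_ge m (n + 1) with h | h
    · exact ih m (by omega)
    · obtain rfl : m = n + 1 := by omega
      have e1 := congrArg (coeff n) hF
      have e2 := congrArg (coeff n) hF'
      rw [coeff_derivative, coeff_mul] at e1 e2
      have hs : ∑ p ∈ antidiagonal n, coeff p.1 (d⁄dX ℝ G) * coeff p.2 F =
          ∑ p ∈ antidiagonal n, coeff p.1 (d⁄dX ℝ G) * coeff p.2 F' := by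
        refine Finset.sum_congr rfl fun p hp => ?_
        have hp2 : p.2 ≤ n := by have := mem_antidiagonal.mp hp; omega
        rw [ih p.2 hp2]
      rw [hs, ← e2] at e1
      have hn : ((n : ℝ) + 1) ≠ 0 := by positivity
      exact mul_right_cancel₀ hn e1

/-- Product rule: `F₁ = exp G₁`, `F₂ = exp G₂` (ODE sense) ⇒ `F₁F₂ = exp (G₁ + G₂)`. -/
theorem expODE_mul {F₁ F₂ G₁ G₂ : PowerSeries ℝ}
    (h1c : constantCoeff F₁ = 1) (h1 : d⁄dX ℝ F₁ = d⁄dX ℝ G₁ * F₁)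
    (h2c : constantCoeff F₂ = 1) (h2 : d⁄dX ℝ F₂ = d⁄dX ℝ G₂ * F₂) :
    constantCoeff (F₁ * F₂) = 1 ∧ d⁄dX ℝ (F₁ * F₂) = d⁄dX ℝ (G₁ + G₂) * (F₁ * F₂) := by
  refine ⟨by rw [map_mul, h1c, h2c, mul_one], ?_⟩
  rw [Derivation.leibniz, map_add, smul_eq_mul, smul_eq_mul, h1, h2]; ring

/-- Derivative of a rescaled series: `(F(aX))′ = a·F′(aX)`. -/
theorem derivative_rescale (a : ℝ) (F : PowerSeries ℝ) :
    d⁄dX ℝ (rescale a F) = C a * rescale a (d⁄dX ℝ F) := by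
  ext n
  rw [coeff_derivative, coeff_rescale, coeff_C_mul, coeff_rescale, coeff_derivative, pow_succ]; ring

/-- Rescaling rule: `F = exp G` (ODE sense) ⇒ `F(aX) = exp G(aX)`. -/
theorem expODE_rescale (a : ℝ) {F G : PowerSeries ℝ}
    (hc : constantCoeff F = 1) (h : d⁄dX ℝ F = d⁄dX ℝ G * F) :
    constantCoeff (rescale a F) = 1 ∧ d⁄dX ℝ (rescale a F) = d⁄dX ℝ (rescale a G) * rescale a F := by
  refine ⟨?_, ?_⟩
  · rw [← coeff_zero_eq_constantCoeff_apply, coeff_rescale, pow_zero, one_mul,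
      coeff_zero_eq_constantCoeff_apply, hc]
  · rw [derivative_rescale, derivative_rescale, h, map_mul]; ring

/-- `e^{−X} := exp(−X)` (ODE sense) for the Mathlib series `rescale (−1) exp`. -/
theorem expODE_expNeg :
    constantCoeff (rescale (-1 : ℝ) (exp ℝ)) = 1 ∧
      d⁄dX ℝ (rescale (-1 : ℝ) (exp ℝ)) = d⁄dX ℝ (-X : PowerSeries ℝ) * rescale (-1 : ℝ) (exp ℝ) := by
  refine ⟨?_, ?_⟩
  · rw [← coeff_zero_eq_constantCoeff_apply, coeff_rescale, pow_zero, one_mul,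
      coeff_zero_eq_constantCoeff_apply, constantCoeff_exp]
  · rw [derivative_rescale, derivative_exp, map_neg (d⁄dX ℝ), derivative_X, map_neg C, map_one]

/-- `e^{X²} := exp(X²)` (ODE sense) for the explicit series `Σ X^{2i}/i!`. -/
theorem expODE_expSq :
    constantCoeff (PowerSeries.mk fun n : ℕ => if Even n then (((n / 2)! : ℝ))⁻¹ else 0) = 1 ∧
      d⁄dX ℝ (PowerSeries.mk fun n : ℕ => if Even n then (((n / 2)! : ℝ))⁻¹ else 0) =
        d⁄dX ℝ ((X : PowerSeries ℝ) ^ 2) *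
          (PowerSeries.mk fun n : ℕ => if Even n then (((n / 2)! : ℝ))⁻¹ else 0) := by
  set S := (PowerSeries.mk fun n : ℕ => if Even n then (((n / 2)! : ℝ))⁻¹ else 0) with hS
  refine ⟨?_, ?_⟩
  · rw [← coeff_zero_eq_constantCoeff_apply, hS, coeff_mk]; simp
  · have hd : d⁄dX ℝ ((X : PowerSeries ℝ) ^ 2) = X * C (2 : ℝ) := by
      rw [derivative_pow, derivative_X, pow_one, mul_one]
      rw [show ((2 : ℕ) : PowerSeries ℝ) = C (2 : ℝ) by rw [map_ofNat]; norm_cast]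
      ring
    rw [hd]
    ext n
    rw [coeff_derivative, hS, coeff_mk, mul_assoc]
    rcases n with _ | k
    · rw [coeff_zero_X_mul]; simp
    · rw [coeff_succ_X_mul, coeff_C_mul, coeff_mk]
      by_cases hk : Even k
      · have hk2 : Even (k + 1 + 1) := by rw [Nat.even_add_one, Nat.even_add_one, not_not]; exact hk
        rw [if_pos hk2, if_pos hk]
        obtain ⟨i, rfl⟩ := hk
        have e1 : (i + i + 1 + 1) / 2 = i + 1 := by omega
        have e2 : (i + i) / 2 = i := by omega
        rw [e1, e2, Nat.factorial_succ]
        push_cast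
        have hi : ((i ! : ℝ)) ≠ 0 := by positivity
        field_simp
        ring
      · have hk2 : ¬ Even (k + 1 + 1) := by rw [Nat.even_add_one, Nat.even_add_one, not_not]; exact hk
        rw [if_neg hk2, if_neg hk]; ring

/-- One step of the moment–cumulant recursion, solved for the moment:
`w_{k+1} = Σ_{i ≤ k} C(k,i) ũ_{i+1} w_{k−i}` (`w = CoeffTable.wR`, `w₀ = 1`). -/
theorem wR_succ_eq_sum {γ : ℕ → ℝ} {M : ℕ} (hM : γ M ≠ 0) (k : ℕ) :
    CoeffTable.wR γ M (k + 1) =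
      ∑ i ∈ range (k + 1), (k.choose i : ℝ) * windowCumulant γ M (i + 1) * CoeffTable.wR γ M (k - i) := by
  have h : windowCumulant γ M (k + 1) = windowSeqDown γ M (k + 1) -
      ∑ i : Fin k, (k.choose i.1 : ℝ) * windowCumulant γ M (i.1 + 1) * windowSeqDown γ M (k - i.1) := by
    rw [windowCumulant]
  have hfin : ∑ i : Fin k, (k.choose i.1 : ℝ) * windowCumulant γ M (i.1 + 1) * windowSeqDown γ M (k - i.1)
      = ∑ i ∈ range k, (k.choose i : ℝ) * windowCumulant γ M (i + 1) * CoeffTable.wR γ M (k - i) := by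
    rw [← Fin.sum_univ_eq_sum_range]
    refine Finset.sum_congr rfl fun i _ => ?_
    rw [CoeffTable.wR_eq_windowSeqDown hM (by have := i.2; omega)]
  rw [Finset.sum_range_succ, Nat.choose_self, Nat.sub_self, CoeffTable.wR_zero hM, Nat.cast_one, one_mul,
    mul_one, ← hfin, CoeffTable.wR_eq_windowSeqDown hM (by omega), h]
  ring

/-- **`R = exp U` (ODE sense)** for `R = Σ w_k X^k/k!` (window moments, `w₀ = 1`) and
`U = Σ ũ_k X^k/k!` (window cumulants): the EGF form of the moment–cumulant recursion. -/
theorem expODE_moment {γ : ℕ → ℝ} {M : ℕ} (hM : γ M ≠ 0) :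
    constantCoeff (PowerSeries.mk fun k => CoeffTable.wR γ M k / (k ! : ℝ)) = 1 ∧
    d⁄dX ℝ (PowerSeries.mk fun k => CoeffTable.wR γ M k / (k ! : ℝ)) =
      d⁄dX ℝ (PowerSeries.mk fun k => windowCumulant γ M k / (k ! : ℝ)) *
        (PowerSeries.mk fun k => CoeffTable.wR γ M k / (k ! : ℝ)) := by
  refine ⟨?_, ?_⟩
  · rw [← coeff_zero_eq_constantCoeff_apply, coeff_mk, CoeffTable.wR_zero hM]; simp
  · ext k
    rw [coeff_derivative, coeff_mk, PowerSeries.coeff_mul, Finset.Nat.sum_antidiagonal_eq_sum_range_succ_mk]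
    simp only [coeff_derivative, coeff_mk]
    rw [wR_succ_eq_sum hM k, Finset.sum_div, Finset.sum_mul]
    refine Finset.sum_congr rfl fun i hi => ?_
    have hik : i ≤ k := Nat.lt_succ_iff.mp (mem_range.mp hi)
    rw [Nat.cast_choose ℝ hik, Nat.factorial_succ, Nat.factorial_succ]
    push_cast
    have h1 : ((i ! : ℝ)) ≠ 0 := by positivity
    have h2 : (((k - i) ! : ℝ)) ≠ 0 := by positivity
    have h3 : ((k ! : ℝ)) ≠ 0 := by positivity
    field_simp

/-- **`E = exp K` (ODE sense)** for `E = Σ e_j(U) X^j` and `K = Σ_{k≥3} U_k X^k/k!`: the defining recursion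
`j·e_j = Σ_{k=3}^{j} U_k/(k−1)!·e_{j−k}` is `E′ = K′E`. -/
theorem expODE_cumulantCoeff (V : ℕ → ℝ) :
    constantCoeff (PowerSeries.mk (cumulantCoeff V)) = 1 ∧
    d⁄dX ℝ (PowerSeries.mk (cumulantCoeff V)) =
      d⁄dX ℝ (PowerSeries.mk fun k => if 3 ≤ k then V k / (k ! : ℝ) else 0) *
        PowerSeries.mk (cumulantCoeff V) := by
  refine ⟨?_, ?_⟩
  · rw [← coeff_zero_eq_constantCoeff_apply, coeff_mk, cumulantCoeff]
  · ext j
    rw [coeff_derivative, coeff_mk, PowerSeries.coeff_mul, Finset.Nat.sum_antidiagonal_eq_sum_range_succ_mk]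
    simp only [coeff_derivative, coeff_mk]
    have h : cumulantCoeff V (j + 1) = (∑ i : Fin (j + 1),
        (if 2 ≤ i.1 then V (i.1 + 1) / ((i.1)! : ℝ) * cumulantCoeff V (j - i.1) else 0)) / ((j : ℝ) + 1) := by
      rw [cumulantCoeff]
    have hfin : ∑ i : Fin (j + 1),
        (if 2 ≤ i.1 then V (i.1 + 1) / ((i.1)! : ℝ) * cumulantCoeff V (j - i.1) else 0) =
        ∑ i ∈ range (j + 1), (if 2 ≤ i then V (i + 1) / ((i)! : ℝ) * cumulantCoeff V (j - i) else 0) := by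
      rw [← Fin.sum_univ_eq_sum_range]
    rw [h, hfin, div_mul_cancel₀ _ (by positivity : ((j : ℝ) + 1) ≠ 0)]
    refine Finset.sum_congr rfl fun i _ => ?_
    by_cases h2 : 2 ≤ i
    · rw [if_pos h2, if_pos (by omega : 3 ≤ i + 1), Nat.factorial_succ]
      push_cast
      have h1 : ((i ! : ℝ)) ≠ 0 := by positivity
      field_simp
    · rw [if_neg h2, if_neg (by omega : ¬ 3 ≤ i + 1)]; simp

/-- `ũ₀ = 0` (convention). -/
theorem windowCumulant_zero (γ : ℕ → ℝ) (M : ℕ) : windowCumulant γ M 0 = 0 := by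
  rw [windowCumulant]

/-- `ũ₁ = r̃₁ = 1`. -/
theorem windowCumulant_one {γ : ℕ → ℝ} {M : ℕ} (hM1 : γ (M - 1) ≠ 0) : windowCumulant γ M 1 = 1 := by
  rw [show (1 : ℕ) = 0 + 1 from rfl, windowCumulant]
  simp only [Finset.univ_eq_empty, Finset.sum_empty, sub_zero, zero_add]
  unfold windowSeqDown
  simp [hM1]

/-- `ũ₂ = r̃₂ − 1 = −2Δ²`. -/
theorem windowCumulant_two {γ : ℕ → ℝ} {M : ℕ} (hM1 : γ (M - 1) ≠ 0) :
    windowCumulant γ M 2 = -2 * gorttwDeltaSq γ M := by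
  rw [show (2 : ℕ) = 1 + 1 from rfl, windowCumulant]
  simp only [Fin.sum_univ_one, Fin.val_zero, Nat.choose_zero_right, Nat.cast_one, one_mul, Nat.sub_zero,
    zero_add]
  rw [windowCumulant_one hM1]
  have h1 : windowSeqDown γ M 1 = 1 := by unfold windowSeqDown; simp [hM1]
  rw [h1]
  unfold gorttwDeltaSq
  ring

/-- The exponent of the assembled series is `K = Σ_{k≥3} Ũ_k X^k/k!`. -/
theorem exponent_eq {γ : ℕ → ℝ} {M : ℕ} (hM1 : γ (M - 1) ≠ 0) (hΔ : 0 < gorttwDeltaSq γ M) :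
    X ^ 2 + rescale (gorttwDelta γ M)⁻¹ ((PowerSeries.mk fun k => windowCumulant γ M k / (k ! : ℝ)) + -X) =
      PowerSeries.mk fun k => if 3 ≤ k then hermiteCumulant γ M k / (k ! : ℝ) else 0 := by
  have hsq : gorttwDelta γ M ^ 2 = gorttwDeltaSq γ M := Real.sq_sqrt hΔ.le
  have hΔ' : gorttwDelta γ M ≠ 0 := (Real.sqrt_pos.mpr hΔ).ne'
  ext k
  rw [map_add, coeff_rescale, map_add, map_neg, coeff_mk, coeff_mk, coeff_X, coeff_X_pow]
  rcases Nat.lt_or_ge k 3 with hk | hk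
  · rw [if_neg (by omega : ¬ 3 ≤ k)]
    interval_cases k
    · rw [windowCumulant_zero]; simp
    · rw [windowCumulant_one hM1]; simp
    · rw [windowCumulant_two hM1, ← hsq]; field_simp; push_cast; ring
  · rw [if_pos hk, if_neg (by omega : k ≠ 2), if_neg (by omega : k ≠ 1)]
    unfold hermiteCumulant
    rw [inv_pow]; ring

/-- **The generating-function identity**: `e^{X²} · (R·e^{−X})(X/Δ) = Σ_j e_j(Ũ(M)) X^j`. -/
theorem assembled_eq_cumulantCoeff {γ : ℕ → ℝ} {M : ℕ} (hM : γ M ≠ 0) (hM1 : γ (M - 1) ≠ 0)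
    (hΔ : 0 < gorttwDeltaSq γ M) :
    (PowerSeries.mk fun n : ℕ => if Even n then (((n / 2)! : ℝ))⁻¹ else 0) *
      rescale (gorttwDelta γ M)⁻¹
        ((PowerSeries.mk fun k => CoeffTable.wR γ M k / (k ! : ℝ)) * rescale (-1 : ℝ) (exp ℝ)) =
      PowerSeries.mk (cumulantCoeff (hermiteCumulant γ M)) := by
  obtain ⟨hRc, hR⟩ := expODE_moment hM
  obtain ⟨hNc, hN⟩ := expODE_expNeg
  obtain ⟨hPc, hP⟩ := expODE_mul hRc hR hNc hN
  obtain ⟨hQc, hQ⟩ := expODE_rescale (gorttwDelta γ M)⁻¹ hPc hP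
  obtain ⟨hSc, hS⟩ := expODE_expSq
  obtain ⟨hCc, hC⟩ := expODE_mul hSc hS hQc hQ
  obtain ⟨hEc, hE⟩ := expODE_cumulantCoeff (hermiteCumulant γ M)
  rw [exponent_eq hM1 hΔ] at hC
  exact expODE_unique hCc hC hEc hE

/-- `[X^j] (e^{X²} · P(X/Δ)) = Σ_{2i ≤ j} (1/i!) Δ^{−(j−2i)} [X^{j−2i}] P`. -/
theorem coeff_expSq_mul_rescale (a : ℝ) (P : PowerSeries ℝ) (j : ℕ) :
    coeff j ((PowerSeries.mk fun n : ℕ => if Even n then (((n / 2)! : ℝ))⁻¹ else 0) * rescale a P) =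
      ∑ i ∈ range (j / 2 + 1), ((i ! : ℝ))⁻¹ * (a ^ (j - 2 * i) * coeff (j - 2 * i) P) := by
  rw [PowerSeries.coeff_mul, Finset.Nat.sum_antidiagonal_eq_sum_range_succ_mk]
  simp only [coeff_mk, coeff_rescale]
  rw [show ∑ k ∈ range (j + 1), (if Even k then (((k / 2)! : ℝ))⁻¹ else 0) * (a ^ (j - k) * coeff (j - k) P)
      = ∑ k ∈ range (j + 1), if Even k then (((k / 2)! : ℝ))⁻¹ * (a ^ (j - k) * coeff (j - k) P) else 0 from
    Finset.sum_congr rfl fun k _ => by split_ifs <;> simp, ← Finset.sum_filter]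
  have hset : (range (j + 1)).filter Even = (range (j / 2 + 1)).image (fun i => 2 * i) := by
    ext k
    simp only [mem_filter, mem_range, mem_image]
    constructor
    · rintro ⟨hk, ⟨r, hr⟩⟩
      exact ⟨r, by omega, by omega⟩
    · rintro ⟨r, hr, rfl⟩
      exact ⟨by omega, ⟨r, by ring⟩⟩
  rw [hset, Finset.sum_image (fun x _ y _ h => by simpa using h)]
  refine Finset.sum_congr rfl fun i _ => ?_
  rw [Nat.mul_div_cancel_left i (by norm_num : 0 < 2)]

/-- The scaled coefficient `S_{d−j}` of the eng seat's closed form is `C(d,j)·j!·[X^j](R·e^{−X})`. -/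
theorem sR_eq_coeff {γ : ℕ → ℝ} {d n j : ℕ} (hj : j ≤ d) :
    CoeffTable.sR γ d n (d - j) = (d.choose j : ℝ) * (j ! : ℝ) *
      coeff j ((PowerSeries.mk fun k => CoeffTable.wR γ (n + d) k / (k ! : ℝ)) *
        rescale (-1 : ℝ) (exp ℝ)) := by
  rw [PowerSeries.coeff_mul, Finset.Nat.sum_antidiagonal_eq_sum_range_succ_mk]
  simp only [coeff_mk, coeff_rescale, coeff_exp]
  unfold CoeffTable.sR
  rw [← Finset.sum_range_reflect _ (d + 1)]
  have h1 : ∑ m ∈ range (d + 1),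
      (if d - j ≤ d + 1 - 1 - m then (CoeffTable.sCoef d (d + 1 - 1 - m) (d - j) : ℝ) *
        CoeffTable.wR γ (n + d) (d - (d + 1 - 1 - m)) else 0) =
      ∑ m ∈ range (d + 1), (if m ≤ j then (CoeffTable.sCoef d (d - m) (d - j) : ℝ) *
        CoeffTable.wR γ (n + d) m else 0) := by
    refine Finset.sum_congr rfl fun m hm => ?_
    have hmd : m ≤ d := Nat.lt_succ_iff.mp (mem_range.mp hm)
    rw [show d + 1 - 1 - m = d - m by omega, show d - (d - m) = m by omega]
    by_cases h : m ≤ j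
    · rw [if_pos (by omega : d - j ≤ d - m), if_pos h]
    · rw [if_neg (by omega : ¬ d - j ≤ d - m), if_neg h]
  rw [h1, ← Finset.sum_filter]
  have hset : (range (d + 1)).filter (fun m => m ≤ j) = range (j + 1) := by
    ext m; simp only [mem_filter, mem_range]; omega
  rw [hset, Finset.mul_sum]
  refine Finset.sum_congr rfl fun m hm => ?_
  have hmj : m ≤ j := Nat.lt_succ_iff.mp (mem_range.mp hm)
  unfold CoeffTable.sCoef
  rw [Nat.choose_symm (by omega : m ≤ d), show d - m - (d - j) = j - m by omega,
    ← Nat.choose_symm (by omega : d - j ≤ d - m), show d - m - (d - j) = j - m by omega]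
  have hmul := Nat.choose_mul (n := d) hmj
  have hmul' : ((d.choose j : ℕ) : ℝ) * (j.choose m : ℕ) = (d.choose m : ℕ) * ((d - m).choose (j - m) : ℕ) := by
    exact_mod_cast hmul
  have hf1 : ((m ! : ℝ)) ≠ 0 := by positivity
  have hf2 : (((j - m)! : ℝ)) ≠ 0 := by positivity
  rw [Nat.cast_choose ℝ hmj] at hmul'
  field_simp at hmul'
  have hq : (algebraMap ℚ ℝ) (1 / ((j - m)! : ℚ)) = 1 / ((j - m)! : ℝ) := by simp
  rw [hq]
  push_cast
  rw [hmul']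
  field_simp

end Cumulant

open Cumulant PowerSeries in
/-- **C0 PROVED (ξ-free, every real sequence `γ`):** GORTTW's Hermite coefficients are the cumulant polynomials,
`c_{d,n,j} = (d)_j · e_j(Ũ₃(M), …, Ũ_j(M))`, `M = n + d`, `0 ≤ j ≤ d`, whenever `Δ(M)² > 0`, `γ(M) ≠ 0`,
`γ(M−1) ≠ 0`. -/
theorem cumulantCoeffIdentity_holds (γ : ℕ → ℝ) : CumulantCoeffIdentity γ := by
  intro d n j hd hj hΔ hM hM1
  have hM1' : γ (n + d - 1) ≠ 0 := hM1
  have hΔ' : 0 < gorttwDelta γ (n + d) := Real.sqrt_pos.mpr hΔ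
  have hsq : gorttwDelta γ (n + d) ^ 2 = gorttwDeltaSq γ (n + d) := Real.sq_sqrt hΔ.le
  have key := CoeffTable.gorttwCoeff_mul_delta_pow hj hM hM1 hΔ
  have hE := congrArg (PowerSeries.coeff j) (assembled_eq_cumulantCoeff hM hM1' hΔ)
  rw [coeff_mk, coeff_expSq_mul_rescale] at hE
  apply mul_right_cancel₀ (pow_ne_zero j hΔ'.ne')
  rw [key, ← hE]
  unfold CoeffTable.tR
  rw [Finset.mul_sum, Finset.sum_mul]
  refine Finset.sum_congr rfl fun i hi => ?_
  have hij : i ≤ j / 2 := Nat.lt_succ_iff.mp (mem_range.mp hi)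
  have h2i : 2 * i ≤ j := by omega
  rw [show d - j + 2 * i = d - (j - 2 * i) by omega, sR_eq_coeff (by omega : j - 2 * i ≤ d), ← hsq]
  set A := coeff (j - 2 * i) ((PowerSeries.mk fun k => CoeffTable.wR γ (n + d) k / (k ! : ℝ)) *
    rescale (-1 : ℝ) (exp ℝ)) with hA
  set Δ := gorttwDelta γ (n + d) with hΔdef
  -- factorial bookkeeping
  have hfac1 : ((d.choose (j - 2 * i) : ℕ) : ℝ) * (((j - 2 * i)! : ℕ) : ℝ) * (((d - j + 2 * i)! : ℕ) : ℝ)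
      = ((d ! : ℕ) : ℝ) := by
    have h := Nat.choose_mul_factorial_mul_factorial (by omega : j - 2 * i ≤ d)
    rw [show d - (j - 2 * i) = d - j + 2 * i by omega] at h
    exact_mod_cast h
  have hfac2 : (((d - j)! : ℕ) : ℝ) * (d.descFactorial j : ℝ) = ((d ! : ℕ) : ℝ) := by
    exact_mod_cast Nat.factorial_mul_descFactorial hj
  have hpow : Δ⁻¹ ^ (j - 2 * i) * Δ ^ j = (Δ ^ 2) ^ i := by
    rw [← pow_mul, show j = (j - 2 * i) + 2 * i by omega, pow_add, Nat.add_sub_cancel, inv_pow,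
      ← mul_assoc, inv_mul_cancel₀ (pow_ne_zero _ hΔ'.ne'), one_mul]
  unfold CoeffTable.qCoef
  push_cast
  have hf1 : ((i ! : ℝ)) ≠ 0 := by positivity
  have hf2 : (((d - j)! : ℝ)) ≠ 0 := by positivity
  have hf3 : (((j - 2 * i)! : ℝ)) ≠ 0 := by positivity
  have hf4 : (((d - j + 2 * i)! : ℝ)) ≠ 0 := by positivity
  -- express the binomial and the falling factorial through factorials
  have hC : ((d.choose (j - 2 * i) : ℕ) : ℝ) = (d ! : ℝ) / (((j - 2 * i)! : ℝ) * ((d - j + 2 * i)! : ℝ)) := by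
    rw [eq_div_iff (mul_ne_zero hf3 hf4)]; linarith [hfac1]
  have hD : (d.descFactorial j : ℝ) = (d ! : ℝ) / ((d - j)! : ℝ) := by
    rw [eq_div_iff hf2]; linarith [hfac2]
  rw [hC, hD]
  calc (Δ ^ 2) ^ i * (((d - j + 2 * i)! : ℝ) / ((i ! : ℝ) * ((d - j)! : ℝ))) *
        ((d ! : ℝ) / (((j - 2 * i)! : ℝ) * ((d - j + 2 * i)! : ℝ)) * ((j - 2 * i)! : ℝ) * A)
      = (Δ⁻¹ ^ (j - 2 * i) * Δ ^ j) * ((d ! : ℝ) / ((i ! : ℝ) * ((d - j)! : ℝ))) * A := by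
        rw [hpow]; field_simp
    _ = (d ! : ℝ) / ((d - j)! : ℝ) * (((i ! : ℝ))⁻¹ * (Δ⁻¹ ^ (j - 2 * i) * A)) * Δ ^ j := by
        field_simp

/-- **C0 for `ξ`'s Taylor data** (the split child `XiCumulantIdentity` of the analytic crux). -/
theorem xiCumulantIdentity_holds : CumulantCoeffIdentity xiTaylorCoeff :=
  cumulantCoeffIdentity_holds xiTaylorCoeff

end Summit.RiemannHypothesis.RiemannHypothesis.Theorems.JensenPolynomials

end
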